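import Literature.NumberTheory.Transcendental.ZilberFieldQuasiminimal
import Literature.NumberTheory.Transcendental.GammaFieldsEcl
import Literature.NumberTheory.Transcendental.RosenlichtProp4Residues
import Mathlib.Algebra.Field.Shrink
import Mathlib.Data.Countable.Small
import HarnessLib

/-!
# Kirby's Theorem 1.2 and Γ-closedness of `ecl`-closed sets in all universes (countable case)

`GammaFieldsEcl.lean` proves, for exponential fields `K : Type` (the universe in which Ax's
theorem `Literature.NumberTheory.Transcendental.ax_schanuel` is stated), Kirby's inequality
`Literature.NumberTheory.Transcendental.succ_le_relTrdeg_of_isEclClosed` (J. Kirby, *Exponential algebraicity in exponential fields*,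
Bull. LMS 42 (2010), Thm 1.2 with `dim ≥ 1`: for `C` `ecl`-closed and `x̄` `ℚ`-linearly
independent modulo `C` with some `xᵢ ∉ C`, `n + 1 ≤ td(x̄, exp x̄/C)`) and its consequence
`Literature.NumberTheory.Transcendental.GammaField.isGammaClosed_span_ecl` (`ecl`-closed sets are Γ-closed, Bays–Kirby 2018
Remark 10.10). This file transfers both to exponential fields in an arbitrary universe, for
*countable* `C` in a field with the *countable closure property* — the case needed for the
quasiminimality of Zilber fields (`ZilberFieldHomogeneity.lean`): all the data live in the
countable, hence `Type`-small, `ecl`-closed E-subfield `F₁ = ecl(C ∪ x̄)` of `K`, in which `ecl`,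
`ecl`-closedness, linear independence modulo `C` and `td(x̄, exp x̄/C)` are the same as in `K`
(`Khovanskii.eclSubfield.image_ecl`, `Khovanskii.image_ecl_equiv`), and `F₁` is isomorphic, as an
exponential field, to a field in `Type` (`Shrink F₁`).

## Contents (all proved)

* `Literature.NumberTheory.Transcendental.EclTransfer.Shrink.instExponentialRing`, `Literature.NumberTheory.Transcendental.EclTransfer.shrinkExpEquiv` — transport of
  the exponential along `Shrink.ringEquiv`.
* `Literature.NumberTheory.Transcendental.EclTransfer.linearIndependent_mkQ_of_comp` — linear independence modulo a set pulls back
  along linear maps.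
* `Literature.NumberTheory.Transcendental.EclTransfer.lift_trdeg_le_of_ringEquiv_of_comp_eq` — `trdeg` is monotone along a base
  isomorphism and an injective compatible ring map (universe-heterogeneous, with `lift`s).
* `Literature.NumberTheory.Transcendental.EclTransfer.lift_relTrdeg_le` — `td(x̄, exp x̄/C)` does not decrease along an injective
  E-ring map.
* `Literature.NumberTheory.Transcendental.succ_le_relTrdeg_of_isEclClosed_of_countable` — Kirby's Thm 1.2 (`dim ≥ 1`) for countable
  `ecl`-closed `C` under CCP, any universe.
* `Literature.NumberTheory.Transcendental.GammaField.isGammaClosed_span_ecl_of_countable` — `ecl C` is Γ-closed for countable `C`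
  under CCP, any universe.

## References

* J. Kirby, *Exponential algebraicity in exponential fields*, Bull. LMS 42 (2010) 879–890: Thm 1.2.
* M. Bays, J. Kirby, *Pseudo-exponential maps, variants, and quasiminimality*, Algebra & Number
  Theory 12 (2018): Remark 10.10, Lemma 4.10.
-/

noncomputable section

open Set Cardinal

universe u v

namespace Literature.NumberTheory.Transcendental

namespace EclTransfer

open Literature.ModelTheory.ExponentialFields.ExponentialRing

/-! ### The exponential on `Shrink` -/

section ShrinkExp

variable (α : Type u) [Field α] [Literature.ModelTheory.ExponentialFields.ExponentialRing α] [Small.{v} α]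

/-- The exponential of `α` transported to `Shrink α` along `Shrink.ringEquiv`. [folklore] -/
instance Shrink.instExponentialRing : Literature.ModelTheory.ExponentialFields.ExponentialRing (Shrink.{v} α) where
  exp a := (Shrink.ringEquiv α).symm (exp (Shrink.ringEquiv α a))
  exp_zero := by rw [map_zero, exp_zero, map_one]
  exp_add x y := by rw [map_add, exp_add, map_mul]

/-- Unfolding lemma for the transported exponential. [folklore] -/
theorem Shrink.exp_def (a : Shrink.{v} α) :
    exp a = (Shrink.ringEquiv α).symm (exp (Shrink.ringEquiv α a)) := rfl

/-- `Shrink.ringEquiv` as an isomorphism of exponential rings. [folklore] -/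
def shrinkExpEquiv : ExponentialRingEquiv (Shrink.{v} α) α :=
  { Shrink.ringEquiv α with
    map_exp' := fun x => by
      show Shrink.ringEquiv α (exp x) = exp (Shrink.ringEquiv α x)
      rw [Shrink.exp_def, RingEquiv.apply_symm_apply] }

/-- `shrinkExpEquiv` is `Shrink.ringEquiv` on elements. [folklore] -/
@[simp] theorem shrinkExpEquiv_apply (x : Shrink.{v} α) :
    shrinkExpEquiv α x = Shrink.ringEquiv α x := rfl

end ShrinkExp

/-! ### Linear independence modulo a set, along linear maps -/

section LinIndep

variable {V W : Type*} [AddCommGroup V] [Module ℚ V] [AddCommGroup W] [Module ℚ W]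

/-- If `φ ∘ x₀` is linearly independent modulo `span (φ '' C₀)` then `x₀` is linearly independent
modulo `span C₀`. [folklore] -/
theorem linearIndependent_mkQ_of_comp (φ : V →ₗ[ℚ] W) {C₀ : Set V} {n : ℕ} {x₀ : Fin n → V}
    (h : LinearIndependent ℚ ((Submodule.span ℚ (φ '' C₀)).mkQ ∘ (φ ∘ x₀))) :
    LinearIndependent ℚ ((Submodule.span ℚ C₀).mkQ ∘ x₀) := by
  rw [Fintype.linearIndependent_iff] at h ⊢
  intro g hg
  apply h g
  have h1 : (Submodule.span ℚ C₀).mkQ (∑ i, g i • x₀ i) = 0 := by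
    simpa [map_sum, map_smul] using hg
  rw [Submodule.mkQ_apply, Submodule.Quotient.mk_eq_zero] at h1
  have h2 : φ (∑ i, g i • x₀ i) ∈ Submodule.span ℚ (φ '' C₀) := by
    rw [Submodule.span_image]; exact Submodule.mem_map_of_mem h1
  have h3 : (Submodule.span ℚ (φ '' C₀)).mkQ (∑ i, g i • (φ ∘ x₀) i) = 0 := by
    rw [Submodule.mkQ_apply, Submodule.Quotient.mk_eq_zero]
    simpa [map_sum, map_smul] using h2
  simpa [map_sum, map_smul] using h3

end LinIndep

/-! ### Transcendence degree along compatible ring maps -/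

section Trdeg

variable {R S A B : Type*} [CommRing R] [CommRing S] [Nontrivial S] [CommRing A] [CommRing B]
  [Algebra R A] [Algebra S B]

/-- **`trdeg` along a base isomorphism and an injective compatible map**: if `f : R ≃+* S`,
`g : A →+* B` is injective and `g ∘ algebraMap = algebraMap ∘ f`, then
`trdeg_R A ≤ trdeg_S B` (every `R`-algebraically independent family of `A` maps to an
`S`-algebraically independent family of `B`, `AlgebraicIndependent.ringHom_of_comp_eq`).
[folklore] -/
theorem lift_trdeg_le_of_ringEquiv_of_comp_eq (f : R ≃+* S) (g : A →+* B)
    (hg : Function.Injective g)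
    (h : (algebraMap S B).comp f.toRingHom = g.comp (algebraMap R A)) :
    Cardinal.lift.{u_4} (Algebra.trdeg R A) ≤ Cardinal.lift.{u_3} (Algebra.trdeg S B) := by
  rw [Algebra.trdeg, Cardinal.lift_iSup Cardinal.bddAbove_of_small]
  refine ciSup_le' fun s => ?_
  have hs : AlgebraicIndependent R ((↑) : s.1 → A) := s.2
  have : AlgebraicIndependent S (g ∘ ((↑) : s.1 → A)) :=
    hs.ringHom_of_comp_eq f g f.surjective hg h
  exact this.lift_cardinalMk_le_trdeg

end Trdeg

/-! ### `td(x̄, exp x̄ / C)` along injective E-ring maps -/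

section RelTrdeg

variable {K₀ : Type v} [Field K₀] [CharZero K₀] [Literature.ModelTheory.ExponentialFields.ExponentialRing K₀]
variable {K : Type u} [Field K] [CharZero K] [Literature.ModelTheory.ExponentialFields.ExponentialRing K]

omit [Literature.ModelTheory.ExponentialFields.ExponentialRing K₀] [Literature.ModelTheory.ExponentialFields.ExponentialRing K] in
/-- An injective ring map sends `ℚ(C₀)` into `ℚ(φ C₀)`. [folklore] -/
theorem mem_adjoin_image_of_mem (φ : K₀ →+* K) {C₀ : Set K₀} {a : K₀}
    (ha : a ∈ IntermediateField.adjoin ℚ C₀) : φ a ∈ IntermediateField.adjoin ℚ (φ '' C₀) := by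
  have : (IntermediateField.adjoin ℚ C₀).map φ.toRatAlgHom =
      IntermediateField.adjoin ℚ (φ.toRatAlgHom '' C₀) := IntermediateField.adjoin_map ℚ C₀ _
  have hmem : φ a ∈ (IntermediateField.adjoin ℚ C₀).map φ.toRatAlgHom := ⟨a, ha, rfl⟩
  rw [this] at hmem
  exact hmem

omit [Literature.ModelTheory.ExponentialFields.ExponentialRing K₀] [Literature.ModelTheory.ExponentialFields.ExponentialRing K] in
/-- Elements of `ℚ(φ C₀)` come from `ℚ(C₀)`. [folklore] -/
theorem exists_of_mem_adjoin_image (φ : K₀ →+* K) {C₀ : Set K₀} {b : K}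
    (hb : b ∈ IntermediateField.adjoin ℚ (φ '' C₀)) :
    ∃ a ∈ IntermediateField.adjoin ℚ C₀, φ a = b := by
  have : (IntermediateField.adjoin ℚ C₀).map φ.toRatAlgHom =
      IntermediateField.adjoin ℚ (φ.toRatAlgHom '' C₀) := IntermediateField.adjoin_map ℚ C₀ _
  have hb' : b ∈ (IntermediateField.adjoin ℚ C₀).map φ.toRatAlgHom := by
    rw [this]; exact hb
  obtain ⟨a, ha, rfl⟩ := hb'
  exact ⟨a, ha, rfl⟩

/-- **`td(x̄, exp x̄/C)` does not decrease along an injective E-ring map** `φ : K₀ → K`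
(`C = φ C₀`, `x̄ = φ ∘ x̄₀`): the towers `ℚ(C₀) ≤ ℚ(C₀)(x̄₀, exp x̄₀)` and
`ℚ(C) ≤ ℚ(C)(x̄, exp x̄)` are matched by `φ`. [folklore] -/
theorem lift_relTrdeg_le (φ : K₀ →+* K) (hφ : ∀ a, φ (exp a) = exp (φ a)) (C₀ : Set K₀) {n : ℕ}
    (x₀ : Fin n → K₀) :
    Cardinal.lift.{u} (relTrdeg C₀ x₀) ≤ Cardinal.lift.{v} (relTrdeg (φ '' C₀) (φ ∘ x₀)) := by
  classical
  set L₀ : IntermediateField ℚ K₀ := IntermediateField.adjoin ℚ C₀ with hL₀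
  set L : IntermediateField ℚ K := IntermediateField.adjoin ℚ (φ '' C₀) with hL
  set T₀ : Set K₀ := range x₀ ∪ range (exp ∘ x₀) with hT₀
  set T : Set K := range (φ ∘ x₀) ∪ range (exp ∘ (φ ∘ x₀)) with hT
  have hTT : φ '' T₀ = T := by
    have e : (φ ∘ (exp ∘ x₀) : Fin n → K) = exp ∘ (φ ∘ x₀) := funext fun i => hφ (x₀ i)
    rw [hT₀, hT, image_union, ← range_comp, ← range_comp, e]
  -- the base isomorphism
  let f₀ : L₀ →+* L := (φ.comp (algebraMap L₀ K₀)).codRestrict L fun a =>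
    mem_adjoin_image_of_mem φ a.2
  have hf₀v : ∀ a : L₀, (f₀ a : K) = φ a := fun a => rfl
  have hf₀ : Function.Bijective f₀ := by
    constructor
    · intro a b hab
      have h1 : (f₀ a : K) = f₀ b := congrArg Subtype.val hab
      rw [hf₀v, hf₀v] at h1
      exact Subtype.ext (φ.injective h1)
    · intro b
      obtain ⟨a, ha, hab⟩ := exists_of_mem_adjoin_image φ b.2
      exact ⟨⟨a, ha⟩, Subtype.ext (by rw [hf₀v]; exact hab)⟩
  let f : L₀ ≃+* L := RingEquiv.ofBijective f₀ hf₀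
  -- the map of the upper fields
  set E₀ : IntermediateField L₀ K₀ := IntermediateField.adjoin L₀ T₀ with hE₀
  set E : IntermediateField L K := IntermediateField.adjoin L T with hE
  have hE₀' : ∀ a : K₀, a ∈ E₀ ↔ a ∈ IntermediateField.adjoin ℚ (C₀ ∪ T₀) := by
    intro a
    rw [← IntermediateField.adjoin_adjoin_left]; rfl
  have hE' : ∀ b : K, b ∈ E ↔ b ∈ IntermediateField.adjoin ℚ (φ '' C₀ ∪ T) := by
    intro b
    rw [← IntermediateField.adjoin_adjoin_left]; rfl
  have hmemE : ∀ a : K₀, a ∈ E₀ → φ a ∈ E := by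
    intro a ha
    rw [hE', ← hTT, ← image_union]
    exact mem_adjoin_image_of_mem φ ((hE₀' a).1 ha)
  let g : E₀ →+* E := (φ.comp (algebraMap E₀ K₀)).codRestrict E fun a => hmemE a a.2
  have hgv : ∀ a : E₀, (g a : K) = φ a := fun a => rfl
  have hg : Function.Injective g := by
    intro a b hab
    have h1 : (g a : K) = g b := congrArg Subtype.val hab
    rw [hgv, hgv] at h1
    exact Subtype.ext (φ.injective h1)
  have hcomp : (algebraMap L E).comp f.toRingHom = g.comp (algebraMap L₀ E₀) := by
    ext a
    show (((f a : L) : K)) = ((g (algebraMap L₀ E₀ a) : E) : K)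
    rw [hgv]
    show ((f₀ a : L) : K) = φ (a : K₀)
    exact hf₀v a
  exact lift_trdeg_le_of_ringEquiv_of_comp_eq f g hg hcomp

end RelTrdeg

end EclTransfer

/-! ### Kirby's Theorem 1.2 (`dim ≥ 1`) in all universes, countable case -/

section Main

open EclTransfer Literature.ModelTheory.ExponentialFields.ExponentialRing

variable {K : Type u} [Field K] [CharZero K] [Literature.ModelTheory.ExponentialFields.ExponentialRing K]

/-- **Kirby 2010, Thm 1.2 with `dim ≥ 1`, in any universe, for countable `ecl`-closed `C` under
the countable closure property**: if `C = ecl C` is countable, `x̄` is `ℚ`-linearly independent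
modulo `C` and `n ≥ 1`, then `n + 1 ≤ td(x̄, exp x̄/C)`. Transferred from
`Literature.NumberTheory.Transcendental.succ_le_relTrdeg_of_isEclClosed` (fields in `Type`) through the countable `ecl`-closed
E-subfield `ecl(C ∪ x̄)` and `Shrink`. [cite: Kirby2010, Thm. 1.2] -/
theorem succ_le_relTrdeg_of_isEclClosed_of_countable (hccp : HasCountableClosureProperty K)
    {C : Set K} (hCc : C.Countable) (hC : IsEclClosed C) {n : ℕ} (hn : 0 < n) {x : Fin n → K}
    (hx : LinearIndependent ℚ ((Submodule.span ℚ C).mkQ ∘ x)) :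
    ((n + 1 : ℕ) : Cardinal) ≤ relTrdeg C x := by
  classical
  -- the countable `ecl`-closed E-subfield `F₁ = ecl (C ∪ range x)`
  set D : Set K := C ∪ range x with hD
  haveI hcnt : Countable (Khovanskii.eclSubfield D) :=
    (hccp D (hCc.union (countable_range x))).to_subtype
  have hCD : C ⊆ ecl D := by
    have : C = ecl C := hC.symm
    rw [this]; exact ecl_mono subset_union_left
  have hxD : ∀ i, x i ∈ ecl D := fun i => subset_ecl D (Or.inr ⟨i, rfl⟩)
  -- a copy in `Type`
  let K₀ : Type := Shrink.{0} (Khovanskii.eclSubfield D)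
  haveI : CharZero K₀ := RingHom.charZero (Shrink.ringEquiv.{0} (Khovanskii.eclSubfield D)).toRingHom
  let Eq : ExponentialRingEquiv K₀ (Khovanskii.eclSubfield D) := shrinkExpEquiv _
  let φ : K₀ →+* K := (Khovanskii.eclSubfield D).subtype.comp Eq.toRingEquiv.toRingHom
  have hφE : ∀ a, φ a = ((Eq a : Khovanskii.eclSubfield D) : K) := fun a => rfl
  have hφexp : ∀ a, φ (exp a) = exp (φ a) := by
    intro a
    rw [hφE, hφE, Eq.map_exp]
    rfl
  have hφinj : Function.Injective φ := φ.injective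
  -- the data in `K₀`
  let C₁ : Set (Khovanskii.eclSubfield D) := Subtype.val ⁻¹' C
  let C₀ : Set K₀ := Eq ⁻¹' C₁
  let x₀ : Fin n → K₀ := fun i => Eq.symm ⟨x i, hxD i⟩
  have hC₁ : ((↑) : Khovanskii.eclSubfield D → K) '' C₁ = C := by
    ext a
    constructor
    · rintro ⟨b, hb, rfl⟩; exact hb
    · intro ha; exact ⟨⟨a, hCD ha⟩, ha, rfl⟩
  have hEC₀ : Eq '' C₀ = C₁ := image_preimage_eq C₁ Eq.surjective
  have hφC : φ '' C₀ = C := by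
    rw [← hC₁, ← hEC₀, image_image]
    rfl
  have hφx : φ ∘ x₀ = x := by
    funext i
    simp [φ, x₀]
  -- (a) `C₀` is `ecl`-closed in `K₀`
  have hC₁cl : ecl C₁ = C₁ := by
    apply Subtype.coe_injective.image_injective
    rw [Khovanskii.eclSubfield.image_ecl D C₁, hC₁]
    exact hC
  have hC₀ : IsEclClosed C₀ := by
    show ecl C₀ = C₀
    have h1 : Eq '' ecl C₀ = Eq '' C₀ := by rw [Khovanskii.image_ecl_equiv Eq C₀, hEC₀, hC₁cl]
    exact (EquivLike.injective Eq).image_injective h1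
  -- (b) linear independence modulo `C₀`
  have hx₀ : LinearIndependent ℚ ((Submodule.span ℚ C₀).mkQ ∘ x₀) := by
    refine linearIndependent_mkQ_of_comp φ.toRatAlgHom.toLinearMap ?_
    have e1 : (φ.toRatAlgHom.toLinearMap : K₀ → K) '' C₀ = C := hφC
    have e2 : (φ.toRatAlgHom.toLinearMap : K₀ → K) ∘ x₀ = x := hφx
    rw [e1, e2]
    exact hx
  -- (c) Kirby's inequality in `K₀ : Type`
  have h0 := succ_le_relTrdeg_of_isEclClosed Transcendental.ax_schanuel_holds hC₀ hn hx₀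
  -- (d) back to `K`
  have h1 := lift_relTrdeg_le φ hφexp C₀ x₀
  rw [hφC, hφx, Cardinal.lift_uzero] at h1
  have h2 : Cardinal.lift.{u} (((n + 1 : ℕ) : Cardinal.{0})) ≤ Cardinal.lift.{u} (relTrdeg C₀ x₀) :=
    Cardinal.lift_le.2 h0
  rw [Cardinal.lift_natCast] at h2
  exact h2.trans h1

end Main

/-! ### Γ-closedness of `ecl C` for countable `C`, in all universes -/

namespace GammaField

open Literature.ModelTheory.ExponentialFields.ExponentialRing

variable {F : Type u} [Field F] [CharZero F] [Literature.ModelTheory.ExponentialFields.ExponentialRing F]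

/-- **`ecl C` is Γ-closed for countable `C` under the countable closure property**, in any
universe (Bays–Kirby 2018, Remark 10.10 with Kirby 2010 Thm 1.2; the proof of
`isGammaClosed_span_ecl` with `succ_le_relTrdeg_of_isEclClosed_of_countable`).
[cite: BaysKirby2018ANT, Remark 10.10] [cite: Kirby2010, Thm. 1.2] -/
theorem isGammaClosed_span_ecl_of_countable (hccp : HasCountableClosureProperty F) {C : Set F}
    (hCc : C.Countable) : IsGammaClosed (Submodule.span ℚ (ecl C)) := by
  classical
  set Λ := Submodule.span ℚ (ecl C) with hΛ
  intro Λ' hle hfg hδ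
  by_contra hne
  haveI := hfg.finite
  set n := ldim Λ Λ' with hn
  have hn0 : n ≠ 0 := by
    rw [hn, Ne, ldim_eq_zero_iff hfg]
    exact fun h => hne (le_antisymm h hle)
  let b := Module.finBasis ℚ ↥(Λ'.map Λ.mkQ)
  have hcard : Module.finrank ℚ ↥(Λ'.map Λ.mkQ) = n := rfl
  have hmem : ∀ i : Fin n, ∃ y ∈ Λ', Λ.mkQ y = (b (Fin.cast hcard.symm i) : F ⧸ Λ) := fun i =>
    Submodule.mem_map.1 (b (Fin.cast hcard.symm i)).2
  choose x hxΛ' hxb using hmem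
  have hx : LinearIndependent ℚ ((Submodule.span ℚ (ecl C)).mkQ ∘ x) := by
    have hb : LinearIndependent ℚ
        (fun i : Fin n => ((b (Fin.cast hcard.symm i) : ↥(Λ'.map Λ.mkQ)) : F ⧸ Λ)) :=
      (b.linearIndependent.map' (Λ'.map Λ.mkQ).subtype (Submodule.ker_subtype _)).comp _
        (Fin.cast_injective _)
    convert hb using 1
    funext i
    exact hxb i
  have hK := succ_le_relTrdeg_of_isEclClosed_of_countable hccp (hccp C hCc) (isEclClosed_ecl C)
    (Nat.pos_of_ne_zero hn0) hx
  have h1 : ((n + 1 : ℕ) : ℕ∞) ≤ (algMatroid F).relRank (ecl C) (range x ∪ range (exp ∘ x)) := by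
    have := (OrderHomClass.mono Cardinal.toENat hK).trans (toENat_relTrdeg_le_relRank (ecl C) x)
    rwa [map_natCast] at this
  have h2 : (algMatroid F).relRank (ecl C) (range x ∪ range (exp ∘ x)) ≤ td Λ Λ' := by
    rw [← td_span_ecl_span_eq]
    calc td Λ (Submodule.span ℚ (range x)) = td Λ (Λ ⊔ Submodule.span ℚ (range x)) :=
          (td_sup_left _ _).symm
      _ ≤ td Λ Λ' := td_mono Λ (sup_le hle (Submodule.span_le.2 (range_subset_iff.2 hxΛ')))
  have h3 : n + 1 ≤ (td Λ Λ').toNat := by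
    have hne' : td Λ Λ' ≠ ⊤ := td_ne_top hfg
    have := h1.trans h2
    rw [← ENat.coe_toNat hne'] at this
    exact_mod_cast this
  have h4 : predim Λ Λ' = ((td Λ Λ').toNat : ℤ) - (n : ℤ) := rfl
  omega

end GammaField

end Literature.NumberTheory.Transcendental
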